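import Literature.Topology.FourManifolds.TracePermutationHandlebody
import Literature.Topology.FourManifolds.BasinCouple

/-!
# Saddle data of a couple of basin settings, and the model conjugations

Topic `Literature/Topology/FourManifolds` (fourth file of the *structure conjugacy* of two
one-level Morse data on a handlebody, support of `stmt-SmoothPoincare4-15190`; the two-function
analogue of `PairSaddles.lean` / `PairSaddlesMC.lean`).  Everything here is **proved**.

For a couple `C : BasinCouple g_A g_B ξ_A ξ_B` (`BasinCouple.lean`) we bundle

* `BasinCouple.SaddleData C` — one-level saddle data `QA` of `A` and `QB` of `B` (the saddle
  data of the diagonal pairs `BasinPair.diag C.A`, `BasinPair.diag C.B` of `PairSaddles.lean`: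
  common saddle values `c_A`, `c_B`, Milnor boxes of the cut-off fields) **of the same size `ε`**,
  with a bijection `σ` of the saddles of `g_A` and `g_B` matching the indices of the boxes;
  `BasinPair.SaddleData.shrink` (all boxes shrunk to a smaller common size) gives existence
  (`SaddleData.nonempty`); `SaddleData.swap`;
* `SaddleData.MC Q s = chartMap (QA.DA s) (QB.DA (σ s))` — **the model conjugation** from the box
  of `s` to the box of `σ s` (identity in Milnor coordinates): it preserves the coordinates,
  **shifts the levels by `c_B - c_A`** (`apply_MC`), is smooth, is inverted by `MCi`, and
  **conjugates the two flows inside the `3ε`-balls** (`MC_θ`).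

## References

* J. Milnor, *Lectures on the h-cobordism theorem* (1965), Def. 3.1 (2), proofs of Thms. 3.12–3.13
  (PDF pp. 12, 17–19). [MilnorHCobordism1965]
-/

open scoped Manifold ContDiff Topology
open Set Function Filter Metric

noncomputable section

namespace Literature.Topology.FourManifolds

open Cobordism FourManifolds.Flow

universe u

variable {n : ℕ} {W : Type u} [TopologicalSpace W] [T2Space W] [SecondCountableTopology W]
  [CompactSpace W] [ChartedSpace (EuclideanHalfSpace (n + 1)) W] [IsManifold (𝓡∂ (n + 1)) ∞ W]

/-! ### Shrinking saddle data -/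

namespace BasinPair.SaddleData

variable {g : W → ℝ} {ξA ξB : Π x : W, TangentSpace (𝓡∂ (n + 1)) x} {P : BasinPair g ξA ξB}

/-- **Saddle data with all boxes shrunk to a smaller common size `ε' ≤ ε`.** [cite: MilnorHCobordism1965, Def. 3.1 (2) (PDF p. 12)] -/
def shrink (Q : P.SaddleData) (ε' : ℝ) (h0 : 0 < ε') (hle : ε' ≤ Q.ε) : P.SaddleData where
  c := Q.c
  apply_eq_c := Q.apply_eq_c
  ε := ε'
  ε_pos := h0
  DA s := (Q.DA s).shrink ε' h0 (by rw [Q.εA]; exact hle)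
  DB s := (Q.DB s).shrink ε' h0 (by rw [Q.εB]; exact hle)
  εA s := rfl
  εB s := rfl
  σ := Q.σ
  k_eq s := by simp only [MilnorBox.shrink_k]; exact Q.k_eq s
  sph_lt := by nlinarith [Q.sph_lt, pow_le_pow_left₀ h0.le hle 2]
  lt_collar := by nlinarith [Q.lt_collar, pow_le_pow_left₀ h0.le hle 2]
  intA s := (closedBall_subset_closedBall (by linarith)).trans (Q.intA s)
  intB s := (closedBall_subset_closedBall (by linarith)).trans (Q.intB s)
  disjA := Q.disjA
  disjB := Q.disjB

/-- The shrunk data have the same value. [folklore] -/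
@[simp] theorem shrink_c (Q : P.SaddleData) (ε' : ℝ) (h0 : 0 < ε') (hle : ε' ≤ Q.ε) : (Q.shrink ε' h0 hle).c = Q.c := rfl

/-- The shrunk data have the prescribed size. [folklore] -/
@[simp] theorem shrink_ε (Q : P.SaddleData) (ε' : ℝ) (h0 : 0 < ε') (hle : ε' ≤ Q.ε) : (Q.shrink ε' h0 hle).ε = ε' := rfl

/-- The shrunk `A`-boxes have the same index. [folklore] -/
@[simp] theorem shrink_DA_k (Q : P.SaddleData) (ε' : ℝ) (h0 : 0 < ε') (hle : ε' ≤ Q.ε) (s : SaddlePt n g) :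
    ((Q.shrink ε' h0 hle).DA s).k = (Q.DA s).k := rfl

/-- The shrunk `A`-boxes have the same coordinates. [folklore] -/
@[simp] theorem coord_shrink_DA (Q : P.SaddleData) (ε' : ℝ) (h0 : 0 < ε') (hle : ε' ≤ Q.ε) (s : SaddlePt n g) :
    ((Q.shrink ε' h0 hle).DA s).coord = (Q.DA s).coord := rfl

end BasinPair.SaddleData

/-! ### Saddle data of a couple -/

namespace BasinCouple

variable {gA gB : W → ℝ} {ξA ξB : Π x : W, TangentSpace (𝓡∂ (n + 1)) x} (C : BasinCouple gA gB ξA ξB)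

/-- **Saddle data of a couple**: one-level saddle data of `A` and of `B` of the same size, a
bijection of the saddles, and matching box indices. [cite: MilnorHCobordism1965, Def. 3.1 (2) (PDF p. 12), Thm. 4.1] -/
structure SaddleData where
  /-- the saddle data of `A` (as a diagonal pair) -/
  QA : (BasinPair.diag C.A).SaddleData
  /-- the saddle data of `B` (as a diagonal pair) -/
  QB : (BasinPair.diag C.B).SaddleData
  /-- same size -/
  ε_eq : QB.ε = QA.ε
  /-- the correspondence of the saddles -/
  σ : SaddlePt n gA ≃ SaddlePt n gB
  /-- corresponding boxes have the same index -/
  k_eq : ∀ s, (QB.DA (σ s)).k = (QA.DA s).k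

/-- The index of a Milnor box at a saddle is the Morse index, when the latter is `< n + 1`. [cite: MilnorHCobordism1965, Def. 3.1, Lemma 2.2] -/
theorem k_eq_morseIndex {g : W → ℝ} {ξ : Π x : W, TangentSpace (𝓡∂ (n + 1)) x} (B : BasinSetting g ξ)
    {X : Π x : W, TangentSpace (𝓡∂ (n + 1)) x} (s : SaddlePt n g) (D : MilnorBox (𝓡∂ (n + 1)) g X s.1)
    (hlt : morseIndex (𝓡∂ (n + 1)) g s.1 < n + 1) : D.k = morseIndex (𝓡∂ (n + 1)) g s.1 := by
  have hsm : ContMDiffAt (𝓡∂ (n + 1)) 𝓘(ℝ, ℝ) 2 g s.1 := B.isMorseFunction.isMorse.contMDiff.contMDiffAt.of_le (by norm_cast)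
  have h := (isMCriticalPt_and_morseIndex_eq_of_eq_milnorQuadratic hsm D.mem_maximalAtlas D.mem_source
    (B.isInteriorPoint_saddle s) D.apply_eq).2
  rw [h] at hlt ⊢
  omega

/-- **Saddle data of a couple exist** for one-level data on both sides (common saddle values
`c_A`, `c_B` between the chart spheres and the collars) and a bijection of the saddles preserving
the Morse indices (all `< n + 1`). [cite: MilnorHCobordism1965, Def. 3.1 (2) (PDF p. 12)] -/
theorem SaddleData.nonempty {cA : ℝ} (hcA : ∀ s : SaddlePt n gA, gA s.1 = cA) (hsphA : C.A.sph < cA)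
    (hcolA : cA < 1 - C.A.S.a') {cB : ℝ} (hcB : ∀ s : SaddlePt n gB, gB s.1 = cB) (hsphB : C.B.sph < cB)
    (hcolB : cB < 1 - C.B.S.a') (σ : SaddlePt n gA ≃ SaddlePt n gB)
    (hidx : ∀ s, morseIndex (𝓡∂ (n + 1)) gB (σ s).1 = morseIndex (𝓡∂ (n + 1)) gA s.1)
    (hlt : ∀ s : SaddlePt n gA, morseIndex (𝓡∂ (n + 1)) gA s.1 < n + 1) : Nonempty C.SaddleData := by
  have heqA : ∀ p, IsMCriticalPt (𝓡∂ (n + 1)) gA p → ∀ᶠ x in 𝓝 p, ξA x = ξA x := fun _ _ => Eventually.of_forall fun _ => rfl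
  have heqB : ∀ p, IsMCriticalPt (𝓡∂ (n + 1)) gB p → ∀ᶠ x in 𝓝 p, ξB x = ξB x := fun _ _ => Eventually.of_forall fun _ => rfl
  obtain ⟨QA₀⟩ := BasinPair.SaddleData.nonempty (BasinPair.diag C.A) heqA hcA hsphA hcolA
  obtain ⟨QB₀⟩ := BasinPair.SaddleData.nonempty (BasinPair.diag C.B) heqB hcB hsphB hcolB
  set ε : ℝ := min QA₀.ε QB₀.ε with hε
  have hε0 : 0 < ε := lt_min QA₀.ε_pos QB₀.ε_pos
  refine ⟨⟨QA₀.shrink ε hε0 (min_le_left _ _), QB₀.shrink ε hε0 (min_le_right _ _), rfl, σ, fun s => ?_⟩⟩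
  simp only [BasinPair.SaddleData.shrink_DA_k]
  rw [k_eq_morseIndex C.A s (QA₀.DA s) (hlt s),
    k_eq_morseIndex C.B (σ s) (QB₀.DA (σ s)) (by rw [hidx]; exact hlt s), hidx]

namespace SaddleData

variable {C} (Q : C.SaddleData)

/-! ### Levels -/

/-- The common size. [folklore] -/
theorem εB_eq : Q.QB.ε = Q.QA.ε := Q.ε_eq

/-- `sph_A < c_A - 9ε²`. [folklore] -/
theorem sph_lt_A : C.A.sph < Q.QA.c - 9 * Q.QA.ε ^ 2 := Q.QA.sph_lt

/-- `sph_B < c_B - 9ε²`. [folklore] -/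
theorem sph_lt_B : C.B.sph < Q.QB.c - 9 * Q.QA.ε ^ 2 := by rw [← Q.ε_eq]; exact Q.QB.sph_lt

/-- `c_A + 9ε² < 1 - a'`. [folklore] -/
theorem lt_collar_A : Q.QA.c + 9 * Q.QA.ε ^ 2 < 1 - C.A.S.a' := Q.QA.lt_collar

/-- `c_B + 9ε² < 1 - a'`. [folklore] -/
theorem lt_collar_B : Q.QB.c + 9 * Q.QA.ε ^ 2 < 1 - C.A.S.a' := by rw [← Q.ε_eq, ← C.a'_eq]; exact Q.QB.lt_collar

/-- The saddles of `A` have the value `c_A`. [folklore] -/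
theorem apply_saddle_A (s : SaddlePt n gA) : gA s.1 = Q.QA.c := Q.QA.apply_eq_c s

/-- The saddles of `B` have the value `c_B`. [folklore] -/
theorem apply_saddle_B (s' : SaddlePt n gB) : gB s'.1 = Q.QB.c := Q.QB.apply_eq_c s'

/-! ### The model conjugations -/

/-- **The model conjugation** from the box of `A` at `s` to the box of `B` at `σ s`: the identity
in Milnor coordinates. [cite: MilnorHCobordism1965, Def. 3.1 and proof of Thm. 3.13] -/
def MC (s : SaddlePt n gA) (x : W) : W := (Q.QA.DA s).chartMap (Q.QB.DA (Q.σ s)) x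

/-- **The inverse model conjugation**, indexed by the `B`-saddle `s'`. [cite: MilnorHCobordism1965, Def. 3.1 and proof of Thm. 3.13] -/
def MCi (s' : SaddlePt n gB) (y : W) : W := (Q.QB.DA s').chartMap (Q.QA.DA (Q.σ.symm s')) y

/-- `MC`, unfolded. [folklore] -/
theorem MC_def (s : SaddlePt n gA) (x : W) : Q.MC s x = (Q.QA.DA s).chartMap (Q.QB.DA (Q.σ s)) x := rfl

/-- `MCi`, unfolded. [folklore] -/
theorem MCi_def (s' : SaddlePt n gB) (y : W) : Q.MCi s' y = (Q.QB.DA s').chartMap (Q.QA.DA (Q.σ.symm s')) y := rfl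

variable {s : SaddlePt n gA} {x : W}

/-- The size of the `B`-box of `σ s` is `ε`. [folklore] -/
theorem ε_DB (s' : SaddlePt n gB) : (Q.QB.DA s').ε = Q.QA.ε := by rw [Q.QB.εA, Q.ε_eq]

/-- The size of the `A`-box of `s` is `ε`. [folklore] -/
theorem ε_DA (s : SaddlePt n gA) : (Q.QA.DA s).ε = Q.QA.ε := Q.QA.εA s

/-- `MC` lands in the chart domain of the `B`-box with the same coordinates (`‖u‖ ≤ 3ε`). [folklore] -/
theorem MC_mem_source_and_coord (hxn : ‖(Q.QA.DA s).coord x‖ ≤ 3 * Q.QA.ε) :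
    Q.MC s x ∈ (Q.QB.DA (Q.σ s)).chart.source ∧ (Q.QB.DA (Q.σ s)).coord (Q.MC s x) = (Q.QA.DA s).coord x :=
  (Q.QA.DA s).chartMap_mem_source_and_coord _ (by rw [Q.ε_DB]; exact hxn)

/-- **`MC` preserves the coordinates.** [folklore] -/
theorem coord_MC (hxn : ‖(Q.QA.DA s).coord x‖ ≤ 3 * Q.QA.ε) :
    (Q.QB.DA (Q.σ s)).coord (Q.MC s x) = (Q.QA.DA s).coord x :=
  (Q.MC_mem_source_and_coord hxn).2

/-- `MC` lands in the chart domain. [folklore] -/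
theorem MC_mem_source (hxn : ‖(Q.QA.DA s).coord x‖ ≤ 3 * Q.QA.ε) : Q.MC s x ∈ (Q.QB.DA (Q.σ s)).chart.source :=
  (Q.MC_mem_source_and_coord hxn).1

/-- `MC` maps chart balls to chart balls (`R ≤ 3ε`). [folklore] -/
theorem MC_mem_chartBall {R : ℝ} (hR : R ≤ 3 * Q.QA.ε) (hx : x ∈ (Q.QA.DA s).chartBall R) :
    Q.MC s x ∈ (Q.QB.DA (Q.σ s)).chartBall R :=
  (Q.QA.DA s).chartMap_mem_chartBall _ (by rw [Q.ε_DB]; exact hR) hx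

/-- **`MC` shifts the levels by `c_B - c_A`** (same normal form, same index). [cite: MilnorHCobordism1965, Def. 3.1] -/
theorem apply_MC (hx : x ∈ (Q.QA.DA s).chart.source) (hxn : ‖(Q.QA.DA s).coord x‖ ≤ 3 * Q.QA.ε) :
    gB (Q.MC s x) = gA x + (Q.QB.c - Q.QA.c) := by
  rw [MC_def, (Q.QA.DA s).apply_chartMap _ (Q.k_eq s).symm hx (by rw [Q.ε_DB]; exact hxn), Q.apply_saddle_A,
    Q.apply_saddle_B]

/-- `MC` sends the saddle to the corresponding saddle. [folklore] -/
theorem MC_self (s : SaddlePt n gA) : Q.MC s s.1 = (Q.σ s).1 := (Q.QA.DA s).chartMap_self _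

/-- `|x⃗|²` is preserved by `MC`. [folklore] -/
theorem sqSumLT_coord_MC (hxn : ‖(Q.QA.DA s).coord x‖ ≤ 3 * Q.QA.ε) :
    sqSumLT (Q.QB.DA (Q.σ s)).k ((Q.QB.DA (Q.σ s)).coord (Q.MC s x)) = sqSumLT (Q.QA.DA s).k ((Q.QA.DA s).coord x) :=
  (Q.QA.DA s).sqSumLT_coord_chartMap _ (Q.k_eq s).symm (by rw [Q.ε_DB]; exact hxn)

/-- `|y⃗|²` is preserved by `MC`. [folklore] -/
theorem sqSumGE_coord_MC (hxn : ‖(Q.QA.DA s).coord x‖ ≤ 3 * Q.QA.ε) :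
    sqSumGE (Q.QB.DA (Q.σ s)).k ((Q.QB.DA (Q.σ s)).coord (Q.MC s x)) = sqSumGE (Q.QA.DA s).k ((Q.QA.DA s).coord x) :=
  (Q.QA.DA s).sqSumGE_coord_chartMap _ (Q.k_eq s).symm (by rw [Q.ε_DB]; exact hxn)

/-- **`MC` is smooth** at the points of the chart domain with `‖u‖ < 3ε`. [folklore] -/
theorem contMDiffAt_MC (hx : x ∈ (Q.QA.DA s).chart.source) (hxn : ‖(Q.QA.DA s).coord x‖ < 3 * Q.QA.ε) :
    ContMDiffAt (𝓡∂ (n + 1)) (𝓡∂ (n + 1)) ∞ (Q.MC s) x :=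
  (Q.QA.DA s).contMDiffAt_chartMap _ hx (by rw [Q.ε_DB]; exact hxn)

/-- The two chart maps are inverse to each other (auxiliary form with an equality of saddles). [folklore] -/
theorem chartMap_chartMap_of_eq {s₁ s₂ : SaddlePt n gA} {t : SaddlePt n gB} (h : s₁ = s₂) {x : W}
    (hx : x ∈ (Q.QA.DA s₁).chart.source) (hxn : ‖(Q.QA.DA s₁).coord x‖ ≤ 3 * Q.QA.ε) :
    (Q.QB.DA t).chartMap (Q.QA.DA s₂) ((Q.QA.DA s₁).chartMap (Q.QB.DA t) x) = x := by
  subst h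
  exact (Q.QA.DA s₁).chartMap_chartMap _ hx (by rw [Q.ε_DB]; exact hxn)

/-- **`MCi (σ s)` inverts `MC s`** on the `3ε`-ball. [folklore] -/
theorem MCi_MC (hx : x ∈ (Q.QA.DA s).chart.source) (hxn : ‖(Q.QA.DA s).coord x‖ ≤ 3 * Q.QA.ε) :
    Q.MCi (Q.σ s) (Q.MC s x) = x :=
  Q.chartMap_chartMap_of_eq (Q.σ.symm_apply_apply s).symm hx hxn

/-- The other composite (auxiliary form). [folklore] -/
theorem chartMap_chartMap_of_eq' {t₁ t₂ : SaddlePt n gB} {s : SaddlePt n gA} (h : t₁ = t₂) {y : W}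
    (hy : y ∈ (Q.QB.DA t₁).chart.source) (hyn : ‖(Q.QB.DA t₁).coord y‖ ≤ 3 * Q.QA.ε) :
    (Q.QA.DA s).chartMap (Q.QB.DA t₂) ((Q.QB.DA t₁).chartMap (Q.QA.DA s) y) = y := by
  subst h
  exact (Q.QB.DA t₁).chartMap_chartMap _ hy (by rw [Q.ε_DA]; exact hyn)

/-- **`MC (σ⁻¹ s')` inverts `MCi s'`** on the `3ε`-ball. [folklore] -/
theorem MC_MCi {s' : SaddlePt n gB} {y : W} (hy : y ∈ (Q.QB.DA s').chart.source)
    (hyn : ‖(Q.QB.DA s').coord y‖ ≤ 3 * Q.QA.ε) : Q.MC (Q.σ.symm s') (Q.MCi s' y) = y :=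
  Q.chartMap_chartMap_of_eq' (Q.σ.apply_symm_apply s').symm hy hyn

/-- **`MC` conjugates the two flows** as long as the `A`-orbit stays in the `3ε`-ball:
`MC (θ_A (t, z)) = θ_B (t, MC z)`. [cite: LeeSmoothManifolds2013, Prop. 9.13] -/
theorem MC_θ {z : W} {T₁ T₂ : ℝ} (hT₁ : T₁ ≤ 0) (hT₂ : 0 ≤ T₂)
    (hmem : ∀ t ∈ Icc T₁ T₂, C.A.θ (t, z) ∈ (Q.QA.DA s).chartBall (3 * Q.QA.ε)) {t : ℝ} (ht : t ∈ Icc T₁ T₂) :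
    Q.MC s (C.A.θ (t, z)) = C.B.θ (t, Q.MC s z) := by
  have hmem' : ∀ t ∈ Icc T₁ T₂, C.A.θ (t, z) ∈ (Q.QA.DA s).chartBall (3 * (Q.QB.DA (Q.σ s)).ε) := by
    rw [Q.ε_DB]; exact hmem
  exact C.A.isFlowOf_X.milnorBox_chartMap_apply_eq C.B.isFlowOf_X C.B.contMDiff_X_one (Q.QA.DA s) (Q.QB.DA (Q.σ s))
    (Q.k_eq s).symm hT₁ hT₂ hmem' ht

/-! ### Swapping -/

/-- **The saddle data of the swapped couple**: `QA`, `QB` exchanged, `σ` inverted. [folklore] -/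
def swap : C.swap.SaddleData where
  QA := Q.QB
  QB := Q.QA
  ε_eq := Q.ε_eq.symm
  σ := Q.σ.symm
  k_eq s' := by
    have h := Q.k_eq (Q.σ.symm s')
    rw [Q.σ.apply_symm_apply] at h
    exact h.symm

/-- `swap.QA = QB`. [folklore] -/
@[simp] theorem swap_QA : Q.swap.QA = Q.QB := rfl

/-- `swap.QB = QA`. [folklore] -/
@[simp] theorem swap_QB : Q.swap.QB = Q.QA := rfl

/-- Swapping twice gives back the data. [folklore] -/
@[simp] theorem swap_swap : Q.swap.swap = Q := rfl

/-- **The model conjugation of the swapped data is `MCi`.** [folklore] -/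
theorem swap_MC (s' : SaddlePt n gB) (y : W) : Q.swap.MC s' y = Q.MCi s' y := rfl

end SaddleData

end BasinCouple

end Literature.Topology.FourManifolds
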